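import Summits.ValiantsHypothesis.ValiantsHypothesis.Theses.ValuativeGCT
import Literature.NumberTheory.DiophantineGeometry.SchurWeylPlethysmKroneckerBoundProofs
import Literature.NumberTheory.DiophantineGeometry.SchurWeylPlethysmOrbitWeightsProofs

/-!
# Crux `ValuativeGCT.ValuativeBound` (stmt-ValiantsHypothesis-12625) — line `det-transversal-order-transport`

Skeleton (crux-plan, round 1) for the idea card
`Cruxes/ValuativeBound/Ideas/det-transversal-order-transport.md` — **now a COMPLETE PROOF of the
crux**: `ValuativeBound_of : ValuativeGCT.ValuativeBound` is sorry-free, `lean check` rc 0, axioms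
`propext`, `Classical.choice`, `Quot.sound`, H21 file audit `ok` with `proof-of-item closed = true`.
The two registered stubs `stub_kernelColumnDivisibility` and `stub_linearPower_of_lineRestriction`
are kept under their registered names and are proved in this file. A prover can land it verbatim as
`Summits/ValiantsHypothesis/ValiantsHypothesis/Theorems/<Name>.lean` (`ledger propose --kind proof
--workitem stmt-ValiantsHypothesis-12625`; split before the `## Glue (proved)` section header if the 400-line lint requires:
the first half `--supports`, the second `--workitem`). It also yields `ValuativeGCT.CoeffVanishingOrder`
(stmt-ValiantsHypothesis-12628) in three lines: `coeffTransport` ∘ stub 2 ∘ stub 1 (see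
`coeffVanishingOrder_of` at the end).

**Idea.** The valuative clause of the truncation `T_U(λ)` — membership of the pulled-back
orbit-closure functions in `I(L_U)^(δ(m-r))` — is decided on the matrix space `W = ℂ^(m×m)`
(`m²` variables), not on `End W` (`m⁴` variables): `det_m` vanishes to order `m - r` along the
linear space `U` of rank-`≤ r` matrices, *pointwise* by kernel columns
(`stub_kernelColumnDivisibility`: `X^(m-r) ∣ det(u + X·y)` for `rank u ≤ r`, by rank normal form),
globalised to the ideal-power statement `C⁺ : det_m ∈ J'_U^(m-r)`, `J'_U` = the ideal of `ℂ[W]`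
spanned by the linear forms vanishing on `U` (`stub_linearPower_of_lineRestriction`, the general
lemma "order of vanishing along a linear subspace is read off one-parameter restrictions", by an
adapted change of variables and an `S`-weight grading argument), and transported to `End W`
coefficientwise along `x ↦ x·A` (`coeffTransport`).

**Contents (all proved; axioms `propext`, `Classical.choice`, `Quot.sound`).**
* `stub_kernelColumnDivisibility` (with `X_pow_card_dvd_det_diagonal_add_smul`): transvection
  normal form `u = P·diag(D)·Q`, `rank u = #{D ≠ 0}`, `u + X·y = P·(diag(C∘D) + X·N)·Q`, and the zero
  rows of `D` carry the factor `X^(m-r)`.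
* `stub_linearPower_of_lineRestriction` (with `sdeg`, `prod_scaled_eq`, `coeff_aeval_scaled`,
  `mem_pow_span_X_of_dvd_scaled` — the coordinate heart: if every `S`-scaled evaluation of `q` is
  divisible by `X^t` then `q ∈ (X_S)^t` — and `linearPower_of_basis` — the change of variables to a
  basis adapted to `U`, built from `Submodule.exists_isCompl`, `Module.finBasis`,
  `Submodule.prodEquivOfIsCompl`, with explicit inverse).
* `coeffTransport` — transport `W → End W` coefficientwise along `x ↦ x·A`:
  `p ∈ J'_U^t ⟹` every `x`-coefficient of `p(x·A)` lies in `I(L_U)^t`,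
  `L_U = {A : every row of A lies in U}` (at `A ∈ L_U` a coefficient of `p(x·A)` is a coefficient of
  `linSubst A ℓ = 0`, `eval_coeff_genericLinSubst`, `MvPolynomial.funext`; then `Ideal.map_span`,
  `Ideal.map_pow`, `Ideal.pow_right_mono`, `MvPolynomial.mem_map_C_iff`).
* `rangeInTruncation` — the `Φ`-injection half: for every class `x` of weight `λ*` in
  `ℂ[Δ(det_m)]`, `orbitCoordToPoly x ∈ T_U(λ)` as soon as every coefficient
  `c_d = genericOrbitMap det_m (X d)` lies in `I(L_U)^t` (threshold `δ t`; no rank hypothesis):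
  degree `mδ` (`isHomogeneous_orbitCoordToPoly` + `size_toMatIdx_dualOfPartition`, consuming
  `card ≤ m*m`), right invariance under EVERY matrix `M` with `M·det_m = det_m` as a polynomial
  identity (`eval_genericOrbitMap`, `linSubst_mul`, `MvPolynomial.funext`), left Borel
  semi-invariance `G(g⁻¹A) = weightChar χ g · G(A)` (`eval_orbitCoordToPoly_mul_left` at `g⁻¹`,
  `weightChar_inv`, `MvPolynomial.eq_of_eval_eq_on_gl`), and the valuative clause by TORUS-WEIGHT
  TRUNCATION of a representative (`sum_filter_monWeight_mem_orbitVanishingIdeal`: the part `F_χ` of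
  `F` of torus weight `χ` represents the same class; its monomials have degree `δ` by
  `size_monWeight`; `genericOrbitMap (X^s) = ∏_d c_d^(s d) ∈ (I^t)^δ` by `Ideal.prod_mem_prod`,
  `Ideal.pow_mem_pow`) — no complete reducibility needed.
* `ValuativeBound_of : ValuativeGCT.ValuativeBound` — the composition (crux concluded by name, no
  hypotheses, stubs invoked by name as the A12 skeleton audit requires): it evaluates `detFormLex` on
  the line `u + X·y` (`aeval_line_detFormLex`: `AlgHom.map_det`, `Matrix.mvPolynomialX`), chains
  stub 1 → stub 2 (`C⁺`) → `coeffTransport` (`genericOrbitMap … (X d)` unfolds to the route's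
  coefficient expression by `rfl`) → `rangeInTruncation`, and counts dimensions with
  `hwToPoly_injective`, `LinearMap.finrank_range_of_inj`, `Submodule.finrank_mono`
  (finite-dimensionality of `T_U(λ) ≤ Hom_(mδ)` from Mathlib `homogeneousSubmodule_fg`).
* `coeffVanishingOrder_of : ValuativeGCT.CoeffVanishingOrder` — the support item stmt-12628, for free.

**Disproof used** (cdisprove `Disproof.lean`, per its evidence notes on the item; the file itself
is not mounted in planner jails): `valuativeBound_false_without_rank` — the rank bound is consumed
exactly once, in `stub_kernelColumnDivisibility` (drop it and stub 1 is false at `u = 1`, `r = 0`);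
`valuativeBound_false_without_card` — `card ≤ m*m` is consumed in `rangeInTruncation` (degree
clause); `coeffVanishingOrder_false_with_columns` — `coeffTransport` is stated and proved with the ROW
convention `{pt | ∀ j, (fun i => pt (j, i)) ∈ U}` and the generic matrix `Matrix.of fun j i => X (j, i)`
verbatim from the route file; `coeffVanishingOrder_false_with_exponent_succ` /
`not_valuativeBoundSharperThreshold` — the exponent is `m - r` (attained at `m = 2`, `u = E₁₁`),
never `m - r + 1`. No landed `Negative/` lemma exists for this crux (nothing to import).
-/

namespace Summit.ValiantsHypothesis.ValiantsHypothesis.Cruxes.ValuativeBound.DetTransversalOrderTransport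

open MvPolynomial
open Literature.NumberTheory.DiophantineGeometry Literature.Computability.AlgebraicComplexity
open Summit.ValiantsHypothesis.ValiantsHypothesis.Theses

/-! ## Stubs -/

/-- Row extraction of `X`: if `D` vanishes on `Z` then `X^(#Z) ∣ det (diagonal (C ∘ D) + X • N)` —
the rows `i ∈ Z` of the matrix are `X •` rows of `N` (factor `diagonal v`, `v i ∈ {X, 1}`,
`Matrix.det_mul`, `Matrix.det_diagonal`). Helper for `stub_kernelColumnDivisibility`. -/
theorem X_pow_card_dvd_det_diagonal_add_smul {m : ℕ} (D : Fin m → ℂ)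
    (N : Matrix (Fin m) (Fin m) (Polynomial ℂ)) (Z : Finset (Fin m)) (hZ : ∀ i ∈ Z, D i = 0) :
    (Polynomial.X : Polynomial ℂ) ^ Z.card ∣
      (Matrix.diagonal (fun i => Polynomial.C (D i)) + (Polynomial.X : Polynomial ℂ) • N).det := by
  set v : Fin m → Polynomial ℂ := fun i => if i ∈ Z then Polynomial.X else 1 with hv
  set N' : Matrix (Fin m) (Fin m) (Polynomial ℂ) := Matrix.of fun i j =>
    if i ∈ Z then N i j
    else (Matrix.diagonal (fun i => Polynomial.C (D i)) + (Polynomial.X : Polynomial ℂ) • N) i j with hN'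
  have hfac : Matrix.diagonal (fun i => Polynomial.C (D i)) + (Polynomial.X : Polynomial ℂ) • N =
      Matrix.diagonal v * N' := by
    ext i j
    rw [Matrix.diagonal_mul, hN', Matrix.of_apply, hv]
    by_cases hi : i ∈ Z
    · have hDi : D i = 0 := hZ i hi
      simp only [hi, if_true, Matrix.add_apply, Matrix.diagonal_apply, hDi, map_zero,
        Matrix.smul_apply, smul_eq_mul, ite_self, zero_add]
    · simp only [hi, if_false, one_mul]
  rw [hfac, Matrix.det_mul, Matrix.det_diagonal]
  refine Dvd.dvd.mul_right ?_ _
  have hprod : ∏ i, v i = (Polynomial.X : Polynomial ℂ) ^ Z.card := by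
    simp only [hv]
    rw [Finset.prod_ite_mem, Finset.univ_inter, Finset.prod_const]
  rw [hprod]

/-- **Stub 1 — kernel-column divisibility** (registered stub; PROVED here, the only place the rank
hypothesis enters). If `rank u ≤ r` then `X^(m-r)` divides `det(u + X·y)` in `ℂ[X]` for every `y`.
Proof: rank normal form `u = P·diag(D)·Q` with `P, Q` products of transvections
(`Matrix.Pivot.exists_list_transvec_mul_diagonal_mul_list_transvec`; inverses
`TransvectionStruct.prod_mul_reverse_inv_prod` / `reverse_inv_prod_mul_prod`, determinant `1`), so
`rank u = #{i : D i ≠ 0}` (`Matrix.rank_mul_eq_left/right_of_isUnit_det`, `Matrix.rank_diagonal`) and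
`u + X·y = P·(diag(C∘D) + X·N)·Q` after mapping by `C` (`RingHom.mapMatrix`), with
`N = P⁻¹·y·Q⁻¹`; the `≥ m - r` zero rows of `D` give the factor `X^(m-r)`
(`X_pow_card_dvd_det_diagonal_add_smul`). Sharp: `m = 2`, `u = E₁₁` gives
`det(u + X·y) = X·y₂₂ + X²(…)` (Disproof `coeffVanishingOrder_false_with_exponent_succ`). Same content
as adapted-basis-one-psg's `DetOneParamDivisibility` (with `r := u.rank`). -/
theorem stub_kernelColumnDivisibility :
    ∀ (m r : ℕ) (u y : Matrix (Fin m) (Fin m) ℂ), u.rank ≤ r →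
      (Polynomial.X : Polynomial ℂ) ^ (m - r) ∣
        (u.map (Polynomial.C : ℂ →+* Polynomial ℂ) +
          (Polynomial.X : Polynomial ℂ) • y.map (Polynomial.C : ℂ →+* Polynomial ℂ)).det := by
  intro m r u y hu
  classical
  obtain ⟨L, L', D, hu'⟩ := Matrix.Pivot.exists_list_transvec_mul_diagonal_mul_list_transvec u
  set P : Matrix (Fin m) (Fin m) ℂ := (L.map Matrix.TransvectionStruct.toMatrix).prod with hP
  set Q : Matrix (Fin m) (Fin m) ℂ := (L'.map Matrix.TransvectionStruct.toMatrix).prod with hQ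
  set Pi : Matrix (Fin m) (Fin m) ℂ :=
    (L.reverse.map (Matrix.TransvectionStruct.toMatrix ∘ Matrix.TransvectionStruct.inv)).prod with hPi
  set Qi : Matrix (Fin m) (Fin m) ℂ :=
    (L'.reverse.map (Matrix.TransvectionStruct.toMatrix ∘ Matrix.TransvectionStruct.inv)).prod with hQi
  have hPPi : P * Pi = 1 := Matrix.TransvectionStruct.prod_mul_reverse_inv_prod L
  have hQiQ : Qi * Q = 1 := Matrix.TransvectionStruct.reverse_inv_prod_mul_prod L'
  have hdetP : P.det = 1 := Matrix.TransvectionStruct.det_toMatrix_prod L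
  have hdetQ : Q.det = 1 := Matrix.TransvectionStruct.det_toMatrix_prod L'
  -- `rank u = #{i : D i ≠ 0}`
  have hrank : u.rank = Fintype.card {i // D i ≠ 0} := by
    rw [hu', Matrix.rank_mul_eq_left_of_isUnit_det Q _ (by rw [hdetQ]; exact isUnit_one),
      Matrix.rank_mul_eq_right_of_isUnit_det P _ (by rw [hdetP]; exact isUnit_one),
      Matrix.rank_diagonal]
  -- the zero set of `D` has at least `m - r` elements
  set Z : Finset (Fin m) := Finset.univ.filter (fun i => D i = 0) with hZ
  have hZmem : ∀ i ∈ Z, D i = 0 := fun i hi => (Finset.mem_filter.mp hi).2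
  have hcard : m - r ≤ Z.card := by
    have h1 : (Finset.univ.filter (fun i : Fin m => D i ≠ 0)).card + Z.card = m := by
      have h := Finset.card_filter_add_card_filter_not
        (s := (Finset.univ : Finset (Fin m))) (p := fun i : Fin m => D i ≠ 0)
      simp only [not_not, Finset.card_univ, Fintype.card_fin] at h
      rw [hZ]
      convert h using 2
    have h2 : (Finset.univ.filter (fun i : Fin m => D i ≠ 0)).card ≤ r := by
      rw [← Fintype.card_subtype, ← hrank]
      exact hu
    omega
  -- factor `u + X·y = P · (diag(C∘D) + X·N) · Q` after mapping by `C`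
  set φ : Matrix (Fin m) (Fin m) ℂ →+* Matrix (Fin m) (Fin m) (Polynomial ℂ) :=
    (Polynomial.C : ℂ →+* Polynomial ℂ).mapMatrix with hφ
  have hφP : φ P * φ Pi = 1 := by rw [← map_mul, hPPi, map_one]
  have hφQ : φ Qi * φ Q = 1 := by rw [← map_mul, hQiQ, map_one]
  have hdiag : φ (Matrix.diagonal D) = Matrix.diagonal fun i => Polynomial.C (D i) := by
    rw [hφ, RingHom.mapMatrix_apply, Matrix.diagonal_map (map_zero Polynomial.C)]
  set N : Matrix (Fin m) (Fin m) (Polynomial ℂ) :=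
    φ Pi * y.map (Polynomial.C : ℂ →+* Polynomial ℂ) * φ Qi with hN
  have hmapu : u.map (Polynomial.C : ℂ →+* Polynomial ℂ) =
      φ P * Matrix.diagonal (fun i => Polynomial.C (D i)) * φ Q := by
    rw [← hdiag, ← map_mul, ← map_mul, ← hu', hφ, RingHom.mapMatrix_apply]
  have hfac : u.map (Polynomial.C : ℂ →+* Polynomial ℂ) +
        (Polynomial.X : Polynomial ℂ) • y.map (Polynomial.C : ℂ →+* Polynomial ℂ) =
      φ P * (Matrix.diagonal (fun i => Polynomial.C (D i)) + (Polynomial.X : Polynomial ℂ) • N) * φ Q := by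
    rw [Matrix.mul_add, Matrix.add_mul, ← hmapu, Matrix.mul_smul, Matrix.smul_mul, hN,
      ← Matrix.mul_assoc, ← Matrix.mul_assoc, hφP, Matrix.one_mul, Matrix.mul_assoc, hφQ,
      Matrix.mul_one]
  rw [hfac, Matrix.det_mul, Matrix.det_mul]
  exact (pow_dvd_pow Polynomial.X hcard).trans
    (((X_pow_card_dvd_det_diagonal_add_smul D N Z hZmem).mul_left _).mul_right _)

/-! ### Stub 2 and its infrastructure (all proved) -/

/-- `S`-weight of a monomial: its total degree in the variables from `S`. -/
def sdeg {τ : Type*} [DecidableEq τ] (S : Finset τ) (a : τ →₀ ℕ) : ℕ :=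
  ∑ e ∈ a.support.filter (· ∈ S), a e

theorem prod_scaled_eq {τ : Type*} [DecidableEq τ] (S : Finset τ) (c : τ → ℂ) (a : τ →₀ ℕ) :
    a.prod (fun e k =>
        (if e ∈ S then Polynomial.X * Polynomial.C (c e) else Polynomial.C (c e)) ^ k) =
      (Polynomial.X : Polynomial ℂ) ^ sdeg S a * Polynomial.C (a.prod fun e k => c e ^ k) := by
  rw [Finsupp.prod, Finsupp.prod, sdeg, Finset.sum_filter, ← Finset.prod_pow_eq_pow_sum, map_prod,
    ← Finset.prod_mul_distrib]
  refine Finset.prod_congr rfl fun e _ => ?_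
  by_cases he : e ∈ S
  · simp only [he, if_true, mul_pow, map_pow]
  · simp only [he, if_false, pow_zero, one_mul, map_pow]

/-- Coefficient `j` of the `S`-scaled evaluation is the evaluation of the `S`-weight-`j` part. -/
theorem coeff_aeval_scaled {τ : Type*} [DecidableEq τ] (S : Finset τ) (c : τ → ℂ)
    (q : MvPolynomial τ ℂ) (j : ℕ) :
    (MvPolynomial.aeval (fun e =>
        if e ∈ S then Polynomial.X * Polynomial.C (c e) else Polynomial.C (c e)) q).coeff j =
      MvPolynomial.eval c (∑ a ∈ q.support.filter (fun a => sdeg S a = j), monomial a (coeff a q)) := by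
  have hL : (MvPolynomial.aeval (fun e =>
        if e ∈ S then Polynomial.X * Polynomial.C (c e) else Polynomial.C (c e)) q).coeff j =
      ∑ a ∈ q.support, if sdeg S a = j then coeff a q * a.prod (fun e k => c e ^ k) else 0 := by
    conv_lhs => rw [q.as_sum, map_sum, Polynomial.finsetSum_coeff]
    refine Finset.sum_congr rfl fun a _ => ?_
    rw [aeval_monomial, prod_scaled_eq, Polynomial.algebraMap_eq, Polynomial.coeff_C_mul,
      mul_comm ((Polynomial.X : Polynomial ℂ) ^ _) _, Polynomial.coeff_C_mul_X_pow]
    by_cases h : sdeg S a = j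
    · simp [h]
    · simp [h, Ne.symm h]
  have hR : MvPolynomial.eval c (∑ a ∈ q.support.filter (fun a => sdeg S a = j), monomial a (coeff a q)) =
      ∑ a ∈ q.support, if sdeg S a = j then coeff a q * a.prod (fun e k => c e ^ k) else 0 := by
    rw [map_sum, Finset.sum_filter]
    refine Finset.sum_congr rfl fun a _ => ?_
    split_ifs with h
    · rw [eval_monomial]
    · rfl
  rw [hL, hR]

/-- **Coordinate heart.** If every `S`-scaled evaluation `q(…, X·c_e (e ∈ S), …, c_e (e ∉ S), …)` is
divisible by `X^t`, then `q` lies in the `t`-th power of the ideal spanned by the variables in `S`. -/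
theorem mem_pow_span_X_of_dvd_scaled {τ : Type*} [DecidableEq τ] (S : Finset τ) (t : ℕ)
    (q : MvPolynomial τ ℂ)
    (h : ∀ c : τ → ℂ, (Polynomial.X : Polynomial ℂ) ^ t ∣
      MvPolynomial.aeval (fun e =>
        if e ∈ S then Polynomial.X * Polynomial.C (c e) else Polynomial.C (c e)) q) :
    q ∈ (Ideal.span ((fun e => (X e : MvPolynomial τ ℂ)) '' (↑S : Set τ))) ^ t := by
  -- (1) the parts of `S`-weight `j < t` vanish identically
  have hpart : ∀ j, j < t →
      (∑ a ∈ q.support.filter (fun a => sdeg S a = j), monomial a (coeff a q)) = 0 := by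
    intro j hj
    apply MvPolynomial.funext
    intro c
    rw [map_zero, ← coeff_aeval_scaled]
    exact (Polynomial.X_pow_dvd_iff.mp (h c)) j hj
  -- (2) hence every monomial of `q` has `S`-weight `≥ t`
  have hdeg : ∀ a ∈ q.support, t ≤ sdeg S a := by
    intro a ha
    by_contra hlt
    push Not at hlt
    have hz := congr_arg (coeff a) (hpart _ hlt)
    rw [coeff_sum, coeff_zero, Finset.sum_eq_single a, coeff_monomial, if_pos rfl] at hz
    · exact (mem_support_iff.mp ha) hz
    · intro b _ hba
      rw [coeff_monomial, if_neg hba]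
    · intro hna
      exact (hna (Finset.mem_filter.mpr ⟨ha, rfl⟩)).elim
  -- (3) and such a monomial lies in the power
  rw [q.as_sum]
  refine Ideal.sum_mem _ fun a ha => ?_
  have hmono : (monomial a (coeff a q) : MvPolynomial τ ℂ) =
      C (coeff a q) * ((∏ e ∈ a.support.filter (· ∈ S), X e ^ a e) *
        ∏ e ∈ a.support.filter (fun e => ¬ e ∈ S), X e ^ a e) := by
    rw [monomial_eq, Finsupp.prod, Finset.prod_filter_mul_prod_filter_not]
  rw [hmono]
  refine Ideal.mul_mem_left _ _ (Ideal.mul_mem_right _ _ ?_)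
  have hmem : ∏ e ∈ a.support.filter (· ∈ S), (X e : MvPolynomial τ ℂ) ^ a e ∈
      ∏ e ∈ a.support.filter (· ∈ S),
        (Ideal.span ((fun e => (X e : MvPolynomial τ ℂ)) '' (↑S : Set τ))) ^ a e :=
    Ideal.prod_mem_prod fun e he =>
      Ideal.pow_mem_pow (Ideal.subset_span
        (Set.mem_image_of_mem (fun e => (X e : MvPolynomial τ ℂ)) (Finset.mem_coe.mpr (Finset.mem_filter.mp he).2))) _
  rw [Finset.prod_pow_eq_pow_sum] at hmem
  exact Ideal.pow_le_pow_right (hdeg a ha) hmem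



/-- **Adapted-basis form of stub 2.** Given a basis `b` of `W` indexed by `ι ⊕ κ` whose `inl`
vectors lie in `U` and such that vectors of `U` have vanishing `inr` coordinates, the one-parameter
divisibility hypothesis forces `p ∈ J'_U^t`. The change of variables `θ = aeval Z`
(`Z k = ∑_i b.repr(e_i)_k • X_i`, the `k`-th coordinate form) has the explicit inverse
`θ' = aeval (X_i ↦ ∑_k (b k)_i • X_k)` (`Basis.sum_repr`), commutes with restriction to lines
(`hθline`), and sends `X_(inr j)` to a linear form vanishing on `U`. -/
theorem linearPower_of_basis (m t : ℕ) (U : Submodule ℂ (MatIdx m → ℂ))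
    (p : MvPolynomial (MatIdx m) ℂ)
    (hp : ∀ u ∈ U, ∀ y : MatIdx m → ℂ, (Polynomial.X : Polynomial ℂ) ^ t ∣
      MvPolynomial.aeval
        (fun i : MatIdx m => Polynomial.C (u i) + Polynomial.X * Polynomial.C (y i)) p)
    {ι κ : Type} [Fintype ι] [Fintype κ] [DecidableEq ι] [DecidableEq κ]
    (b : Module.Basis (ι ⊕ κ) ℂ (MatIdx m → ℂ))
    (hb_inl : ∀ i, b (Sum.inl i) ∈ U) (hb_inr : ∀ u ∈ U, ∀ j, b.repr u (Sum.inr j) = 0) :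
    p ∈ (Ideal.span {ℓ : MvPolynomial (MatIdx m) ℂ |
        ℓ ∈ MvPolynomial.homogeneousSubmodule (MatIdx m) ℂ 1 ∧
          ∀ u ∈ U, MvPolynomial.eval u ℓ = 0}) ^ t := by
  classical
  -- standard vectors and the coordinate functionals of `b` as linear forms
  set std : MatIdx m → (MatIdx m → ℂ) := fun i j => if i = j then 1 else 0 with hstd
  set Z : ι ⊕ κ → MvPolynomial (MatIdx m) ℂ := fun k => ∑ i, b.repr (std i) k • X i with hZ
  have hZlin : ∀ (k : ι ⊕ κ) (v : MatIdx m → ℂ), ∑ i, b.repr (std i) k * v i = b.repr v k := by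
    intro k v
    have h := LinearMap.pi_apply_eq_sum_univ ((Finsupp.lapply k).comp b.repr.toLinearMap) v
    simp only [LinearMap.comp_apply, Finsupp.lapply_apply, LinearEquiv.coe_coe, smul_eq_mul] at h
    rw [h]
    exact Finset.sum_congr rfl fun i _ => mul_comm _ _
  -- the change of variables `θ : X_k ↦ Z_k` and its inverse `θ'`
  set θ : MvPolynomial (ι ⊕ κ) ℂ →ₐ[ℂ] MvPolynomial (MatIdx m) ℂ := MvPolynomial.aeval Z with hθ
  set θ' : MvPolynomial (MatIdx m) ℂ →ₐ[ℂ] MvPolynomial (ι ⊕ κ) ℂ :=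
    MvPolynomial.aeval (fun i : MatIdx m => ∑ k, (b k i) • (X k : MvPolynomial (ι ⊕ κ) ℂ)) with hθ'
  have hθθ' : ∀ q, θ (θ' q) = q := by
    intro q
    suffices H : θ.comp θ' = AlgHom.id ℂ _ from congrArg (fun φ : MvPolynomial (MatIdx m) ℂ →ₐ[ℂ] _ => φ q) H
    apply MvPolynomial.algHom_ext
    intro i
    have hcoef : ∀ i', ∑ k, b k i * b.repr (std i') k = if i' = i then 1 else 0 := by
      intro i'
      have h := congr_fun (b.sum_repr (std i')) i
      simp only [Finset.sum_apply, Pi.smul_apply, smul_eq_mul, hstd] at h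
      rw [← h]
      exact Finset.sum_congr rfl fun k _ => mul_comm _ _
    simp only [AlgHom.comp_apply, AlgHom.id_apply, hθ', aeval_X, map_sum, map_smul, hθ, hZ,
      Finset.smul_sum, smul_smul]
    rw [Finset.sum_comm]
    simp only [← Finset.sum_smul, hcoef, ite_smul, one_smul, zero_smul, Finset.sum_ite_eq',
      Finset.mem_univ, if_true]
  -- `θ` commutes with restriction to lines
  have hθline : ∀ (u y : MatIdx m → ℂ) (q : MvPolynomial (ι ⊕ κ) ℂ),
      MvPolynomial.aeval (fun i : MatIdx m => Polynomial.C (u i) + Polynomial.X * Polynomial.C (y i)) (θ q) =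
      MvPolynomial.aeval (fun k => Polynomial.C (b.repr u k) + Polynomial.X * Polynomial.C (b.repr y k)) q := by
    intro u y q
    have hfun : (fun k : ι ⊕ κ => MvPolynomial.aeval
          (fun i : MatIdx m => Polynomial.C (u i) + Polynomial.X * Polynomial.C (y i)) (Z k)) =
        fun k => Polynomial.C (b.repr u k) + Polynomial.X * Polynomial.C (b.repr y k) := by
      funext k
      simp only [hZ, map_sum, map_smul, aeval_X, smul_add, Finset.sum_add_distrib]
      rw [← hZlin k u, ← hZlin k y, map_sum, map_sum, Finset.mul_sum]
      congr 1
      · exact Finset.sum_congr rfl fun i _ => by rw [Polynomial.smul_eq_C_mul, map_mul]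
      · exact Finset.sum_congr rfl fun i _ => by rw [Polynomial.smul_eq_C_mul, map_mul, mul_left_comm]
    rw [hθ, comp_aeval_apply, hfun]
  -- pull `p` back: `p = θ q`
  set q := θ' p with hq
  have hpq : p = θ q := (hθθ' p).symm
  -- the transverse indices
  set S : Finset (ι ⊕ κ) := Finset.univ.filter (fun k => Sum.isRight k = true) with hS
  have hS_inl : ∀ i, (Sum.inl i : ι ⊕ κ) ∉ S := by intro i; simp [hS]
  have hS_inr : ∀ j, (Sum.inr j : ι ⊕ κ) ∈ S := by intro j; simp [hS]
  -- the heart applies to `q`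
  have hqmem : q ∈ (Ideal.span ((fun k => (X k : MvPolynomial (ι ⊕ κ) ℂ)) '' (↑S : Set (ι ⊕ κ)))) ^ t := by
    apply mem_pow_span_X_of_dvd_scaled
    intro c
    set u : MatIdx m → ℂ := ∑ i, c (Sum.inl i) • b (Sum.inl i) with hu
    set y : MatIdx m → ℂ := ∑ j, c (Sum.inr j) • b (Sum.inr j) with hy
    have huU : u ∈ U := U.sum_mem fun i _ => U.smul_mem _ (hb_inl i)
    have hru_inl : ∀ i, b.repr u (Sum.inl i) = c (Sum.inl i) := by
      intro i; simp [hu, Finsupp.single_apply]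
    have hru_inr : ∀ j, b.repr u (Sum.inr j) = 0 := by
      intro j; simp [hu]
    have hry_inl : ∀ i, b.repr y (Sum.inl i) = 0 := by
      intro i; simp [hy]
    have hry_inr : ∀ j, b.repr y (Sum.inr j) = c (Sum.inr j) := by
      intro j; simp [hy, Finsupp.single_apply]
    have hfun : (fun e : ι ⊕ κ =>
        if e ∈ S then Polynomial.X * Polynomial.C (c e) else Polynomial.C (c e)) =
        fun k => Polynomial.C (b.repr u k) + Polynomial.X * Polynomial.C (b.repr y k) := by
      funext k
      rcases k with i | j
      · simp [hS_inl, hru_inl, hry_inl]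
      · simp [hS_inr, hru_inr, hry_inr]
    rw [hfun, ← hθline, ← hpq]
    exact hp u huU y
  -- the transverse coordinate forms vanish on `U`, so `θ` maps the monomial ideal into `J'_U`
  have hmap : Ideal.map θ (Ideal.span ((fun k => (X k : MvPolynomial (ι ⊕ κ) ℂ)) '' (↑S : Set (ι ⊕ κ)))) ≤
      Ideal.span {ℓ : MvPolynomial (MatIdx m) ℂ |
        ℓ ∈ MvPolynomial.homogeneousSubmodule (MatIdx m) ℂ 1 ∧ ∀ u ∈ U, MvPolynomial.eval u ℓ = 0} := by
    rw [Ideal.map_span]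
    apply Ideal.span_mono
    rintro _ ⟨_, ⟨k, hk, rfl⟩, rfl⟩
    obtain ⟨j, rfl⟩ : ∃ j, k = Sum.inr j := by
      rcases k with i | j
      · exact absurd hk (hS_inl i)
      · exact ⟨j, rfl⟩
    refine ⟨?_, ?_⟩
    · show θ (X (Sum.inr j)) ∈ MvPolynomial.homogeneousSubmodule (MatIdx m) ℂ 1
      rw [hθ, aeval_X]
      exact Submodule.sum_mem _ fun i _ =>
        Submodule.smul_mem _ _ ((mem_homogeneousSubmodule 1 _).mpr (isHomogeneous_X ℂ i))
    · intro u hu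
      show MvPolynomial.eval u (θ (X (Sum.inr j))) = 0
      rw [hθ, aeval_X]
      simp only [hZ, map_sum, smul_eval, eval_X]
      rw [hZlin, hb_inr u hu j]
  rw [hpq]
  have h1 := Ideal.mem_map_of_mem θ hqmem
  rw [Ideal.map_pow] at h1
  exact Ideal.pow_right_mono hmap t h1

/-- **Stub 2 — order of vanishing along a linear subspace is read off one-parameter
restrictions** (registered stub; PROVED here — globalisation on `W`; no rank, no determinant). If for
every `u ∈ U` and every direction `y` the univariate restriction `X ↦ p(u + X·y)` is divisible by
`X^t`, then `p` lies in the `t`-th power of the ideal spanned by the linear forms vanishing on `U`.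
Proof: a complement `U'` (`Submodule.exists_isCompl`) and `Module.finBasis` of `U`, `U'` give a basis
`b` of `W` adapted to `U` (`Basis.prod`, `Basis.map`, `Submodule.prodEquivOfIsCompl`); then
`linearPower_of_basis`: the change of variables `θ : X_k ↦ (k-th b-coordinate form)` with inverse
`θ'` (both `MvPolynomial.aeval`; `Basis.sum_repr`, `LinearMap.pi_apply_eq_sum_univ`) commutes with
restriction to lines, the pulled-back polynomial satisfies the hypothesis of the coordinate heart
`mem_pow_span_X_of_dvd_scaled` (the `X^j`-coefficient of an `S`-scaled evaluation is the evaluation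
of the `S`-weight-`j` part, `coeff_aeval_scaled`; `Polynomial.X_pow_dvd_iff`, `MvPolynomial.funext`;
monomials of `S`-weight `≥ t` lie in `(X_S)^t`), and `θ` maps `(X_S)^t` into `J'_U^t` because the
transverse coordinate forms are linear forms vanishing on `U` (`Ideal.map_span`, `Ideal.map_pow`,
`Ideal.pow_right_mono`). -/
theorem stub_linearPower_of_lineRestriction :
    ∀ (m t : ℕ) (U : Submodule ℂ (MatIdx m → ℂ)) (p : MvPolynomial (MatIdx m) ℂ),
      (∀ u ∈ U, ∀ y : MatIdx m → ℂ,
        (Polynomial.X : Polynomial ℂ) ^ t ∣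
          MvPolynomial.aeval
            (fun i : MatIdx m => Polynomial.C (u i) + Polynomial.X * Polynomial.C (y i)) p) →
      p ∈ (Ideal.span {ℓ : MvPolynomial (MatIdx m) ℂ |
              ℓ ∈ MvPolynomial.homogeneousSubmodule (MatIdx m) ℂ 1 ∧
                ∀ u ∈ U, MvPolynomial.eval u ℓ = 0}) ^ t := by
  intro m t U p hp
  obtain ⟨U', hc⟩ := Submodule.exists_isCompl U
  set e : (↥U × ↥U') ≃ₗ[ℂ] (MatIdx m → ℂ) := Submodule.prodEquivOfIsCompl U U' hc with he
  set b : Module.Basis (Fin (Module.finrank ℂ ↥U) ⊕ Fin (Module.finrank ℂ ↥U')) ℂ (MatIdx m → ℂ) :=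
    ((Module.finBasis ℂ ↥U).prod (Module.finBasis ℂ ↥U')).map e with hb
  refine linearPower_of_basis m t U p hp b (fun i => ?_) (fun u hu j => ?_)
  · have h1 : b (Sum.inl i) = ((Module.finBasis ℂ ↥U) i : MatIdx m → ℂ) := by
      rw [hb, Module.Basis.map_apply, he, Submodule.coe_prodEquivOfIsCompl',
        Module.Basis.prod_apply_inl_fst, Module.Basis.prod_apply_inl_snd, Submodule.coe_zero, add_zero]
    rw [h1]
    exact Submodule.coe_mem _
  · rw [hb, Module.Basis.map_repr, LinearEquiv.trans_apply, Module.Basis.prod_repr_inr, he,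
      (Submodule.prodEquivOfIsCompl_symm_apply_snd_eq_zero U U' hc).mpr hu, map_zero, Finsupp.zero_apply]


/-! ## Glue (proved) -/

/-- `det_m` restricted to the line `u + X·y` of `W` is the determinant of the matrix of univariate
polynomials `u + X·y` (reshaping `MatIdx m = Fin m ×ₗ Fin m` by `toLex`). -/
theorem aeval_line_detFormLex (m : ℕ) (u y : MatIdx m → ℂ) :
    MvPolynomial.aeval
        (fun i : MatIdx m => Polynomial.C (u i) + Polynomial.X * Polynomial.C (y i)) (detFormLex ℂ m) =
      ((Matrix.of fun a b : Fin m => u (toLex (a, b))).map (Polynomial.C : ℂ →+* Polynomial ℂ) +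
        (Polynomial.X : Polynomial ℂ) •
          (Matrix.of fun a b : Fin m => y (toLex (a, b))).map (Polynomial.C : ℂ →+* Polynomial ℂ)).det := by
  rw [detFormLex, MvPolynomial.aeval_rename, Literature.Computability.AlgebraicComplexity.detPoly,
    AlgHom.map_det]
  congr 1
  ext a b
  simp only [AlgHom.mapMatrix_apply, Matrix.map_apply, Matrix.mvPolynomialX_apply,
    MvPolynomial.aeval_X, Function.comp_apply, Matrix.add_apply, Matrix.smul_apply,
    Matrix.of_apply, smul_eq_mul]

/-- **Coefficientwise transport `W → End W`** along `x ↦ x·A` (`linSubst` at the generic matrix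
`A j i = X (j, i)`, rows `j`) — proved (it was the idea card's third rung). A polynomial `ℓ`
vanishing on `U` goes to `ℓ(x·A)`, all of whose `x`-coefficients vanish on
`L_U = {A : every row of A lies in U}` (evaluate with `eval_coeff_genericLinSubst`: at `A ∈ L_U` the
coefficient is a coefficient of `linSubst A ℓ`, and `linSubst A ℓ = 0` because every point
`∑_j x_j row_j(A)` lies in `U`); hence `Ideal.map ψ J'_U ≤ Ideal.map C I(L_U)` and
`p ∈ J'_U^t ⟹ p(x·A) ∈ (map C I(L_U))^t = map C (I(L_U)^t)` (`Ideal.map_span`, `Ideal.map_pow`,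
`Ideal.pow_right_mono`), i.e. every `x`-coefficient lies in `I(L_U)^t`
(`MvPolynomial.mem_map_C_iff`). ROW convention load-bearing (Disproof
`coeffVanishingOrder_false_with_columns`). -/
theorem coeffTransport (m t : ℕ) (U : Submodule ℂ (MatIdx m → ℂ)) (p : MvPolynomial (MatIdx m) ℂ)
    (hp : p ∈ (Ideal.span {ℓ : MvPolynomial (MatIdx m) ℂ |
              ℓ ∈ MvPolynomial.homogeneousSubmodule (MatIdx m) ℂ 1 ∧
                ∀ u ∈ U, MvPolynomial.eval u ℓ = 0}) ^ t)
    (d : MatIdx m →₀ ℕ) :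
    MvPolynomial.coeff d
        (linSubst (MatIdx m) (MvPolynomial (MatIdx m × MatIdx m) ℂ)
          (Matrix.of fun j i : MatIdx m => MvPolynomial.X (j, i))
          (MvPolynomial.map MvPolynomial.C p)) ∈
      (MvPolynomial.vanishingIdeal ℂ
          {pt : MatIdx m × MatIdx m → ℂ | ∀ j : MatIdx m, (fun i => pt (j, i)) ∈ U}) ^ t := by
  set ψ : MvPolynomial (MatIdx m) ℂ →+*
      MvPolynomial (MatIdx m) (MvPolynomial (MatIdx m × MatIdx m) ℂ) :=
    (linSubst (MatIdx m) (MvPolynomial (MatIdx m × MatIdx m) ℂ)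
        (Matrix.of fun j i : MatIdx m => MvPolynomial.X (j, i))).toRingHom.comp
      (MvPolynomial.map (MvPolynomial.C : ℂ →+* MvPolynomial (MatIdx m × MatIdx m) ℂ)) with hψ
  set P : Ideal (MvPolynomial (MatIdx m × MatIdx m) ℂ) := MvPolynomial.vanishingIdeal ℂ
      {pt : MatIdx m × MatIdx m → ℂ | ∀ j : MatIdx m, (fun i => pt (j, i)) ∈ U} with hPdef
  -- the generators go to `map C P`
  have hgen : Ideal.map ψ (Ideal.span {ℓ : MvPolynomial (MatIdx m) ℂ |
        ℓ ∈ MvPolynomial.homogeneousSubmodule (MatIdx m) ℂ 1 ∧ ∀ u ∈ U, MvPolynomial.eval u ℓ = 0}) ≤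
      Ideal.map (MvPolynomial.C : MvPolynomial (MatIdx m × MatIdx m) ℂ →+*
        MvPolynomial (MatIdx m) (MvPolynomial (MatIdx m × MatIdx m) ℂ)) P := by
    rw [Ideal.map_span, Ideal.span_le]
    rintro _ ⟨ℓ, ⟨-, hℓU⟩, rfl⟩
    rw [SetLike.mem_coe, MvPolynomial.mem_map_C_iff]
    intro e
    rw [hPdef, MvPolynomial.mem_vanishingIdeal_iff]
    intro pt hpt
    set Pt : Matrix (MatIdx m) (MatIdx m) ℂ := Matrix.of fun j i => pt (j, i) with hPt
    -- at `pt` the coefficient is a coefficient of `linSubst Pt ℓ`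
    have hev : MvPolynomial.eval pt (MvPolynomial.coeff e (ψ ℓ)) =
        MvPolynomial.coeff e (linSubst (MatIdx m) ℂ Pt ℓ) := by
      have h := eval_coeff_genericLinSubst ℓ e Pt
      have hfun : (fun ij : MatIdx m × MatIdx m => Pt ij.1 ij.2) = pt := by
        funext ij
        rfl
      rw [hfun] at h
      exact h
    -- and `linSubst Pt ℓ = 0`, every point `∑_j x_j • row_j(pt)` lying in `U`
    have hzero : linSubst (MatIdx m) ℂ Pt ℓ = 0 := by
      apply MvPolynomial.funext
      intro x
      rw [map_zero]
      have hw : (fun i : MatIdx m => ∑ j, Pt j i * x j) ∈ U := by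
        have hsum : (fun i : MatIdx m => ∑ j, Pt j i * x j) =
            ∑ j, x j • (fun i : MatIdx m => pt (j, i)) := by
          funext i
          simp only [Finset.sum_apply, Pi.smul_apply, smul_eq_mul, hPt, Matrix.of_apply]
          exact Finset.sum_congr rfl fun j _ => mul_comm _ _
        rw [hsum]
        exact U.sum_mem fun j _ => U.smul_mem _ (hpt j)
      have hfun : (fun i : MatIdx m => MvPolynomial.aeval x
          (∑ j, Pt j i • (MvPolynomial.X j : MvPolynomial (MatIdx m) ℂ))) =
          fun i => ∑ j, Pt j i * x j := by
        funext i
        simp only [map_sum, map_smul, MvPolynomial.aeval_X, smul_eq_mul]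
      calc MvPolynomial.eval x (linSubst (MatIdx m) ℂ Pt ℓ)
          = MvPolynomial.aeval x (MvPolynomial.aeval
              (fun i : MatIdx m => ∑ j, Pt j i • (MvPolynomial.X j : MvPolynomial (MatIdx m) ℂ)) ℓ) :=
            rfl
        _ = MvPolynomial.aeval (fun i : MatIdx m => MvPolynomial.aeval x
              (∑ j, Pt j i • (MvPolynomial.X j : MvPolynomial (MatIdx m) ℂ))) ℓ :=
            comp_aeval_apply _ _ _
        _ = MvPolynomial.eval (fun i : MatIdx m => ∑ j, Pt j i * x j) ℓ := by
            rw [hfun]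
            rfl
        _ = 0 := hℓU _ hw
    change MvPolynomial.eval pt (MvPolynomial.coeff e (ψ ℓ)) = 0
    rw [hev, hzero, MvPolynomial.coeff_zero]
  -- transport the power along `ψ`
  have hmem : ψ p ∈ Ideal.map (MvPolynomial.C : MvPolynomial (MatIdx m × MatIdx m) ℂ →+*
      MvPolynomial (MatIdx m) (MvPolynomial (MatIdx m × MatIdx m) ℂ)) (P ^ t) := by
    have h1 : ψ p ∈ (Ideal.map ψ (Ideal.span {ℓ : MvPolynomial (MatIdx m) ℂ |
        ℓ ∈ MvPolynomial.homogeneousSubmodule (MatIdx m) ℂ 1 ∧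
          ∀ u ∈ U, MvPolynomial.eval u ℓ = 0})) ^ t := by
      rw [← Ideal.map_pow]
      exact Ideal.mem_map_of_mem ψ hp
    rw [Ideal.map_pow]
    exact Ideal.pow_right_mono hgen t h1
  exact MvPolynomial.mem_map_C_iff.mp hmem d

/-! ## The `Φ`-injection half (proved here; shared with the `hwtopoly-*` cards) -/

/-- **The pull-back of a highest-weight class lands in the truncation.** For `x` of weight `λ*` in
`ℂ[Δ(det_m)]`, `P = orbitCoordToPoly x` is homogeneous of degree `mδ`
(`isHomogeneous_orbitCoordToPoly` + `size_toMatIdx_dualOfPartition`, uses `card ≤ m*m`), right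
`Stab(det_m)`-invariant as a polynomial identity for every `M` with `M·det_m = det_m`
(`eval_genericOrbitMap`, `linSubst_mul`, `MvPolynomial.funext`), left Borel semi-invariant
(`eval_orbitCoordToPoly_mul_left` at `g⁻¹`, `weightChar_inv`, `MvPolynomial.eq_of_eval_eq_on_gl`),
and lies in `I(L_U)^(δ t)` as soon as every coefficient `c_d = genericOrbitMap det_m (X d)` lies in
`I(L_U)^t`: the class `x = mk F` is also represented by the part `F_χ` of `F` of torus weight `χ`
(`sum_filter_monWeight_mem_orbitVanishingIdeal`), whose monomials all have degree `δ`
(`size_monWeight`), and `genericOrbitMap (X^s) = ∏_d c_d^(s d) ∈ (I^t)^δ`. No rank hypothesis and no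
complete reducibility is used. -/
theorem rangeInTruncation (m : ℕ) [NeZero m] (U : Submodule ℂ (MatIdx m → ℂ)) (t δ : ℕ)
    (lam : Nat.Partition (m * δ)) (hcard : lam.parts.card ≤ m * m)
    (hcoeff : ∀ d : DegIdx (MatIdx m) m,
      genericOrbitMap (detFormLex ℂ m) m (MvPolynomial.X d) ∈
        (MvPolynomial.vanishingIdeal ℂ
          {pt : MatIdx m × MatIdx m → ℂ | ∀ j : MatIdx m, (fun i => pt (j, i)) ∈ U}) ^ t) :
    let χ : Literature.NumberTheory.DiophantineGeometry.Weight (Literature.NumberTheory.DiophantineGeometry.MatIdx m) := (Literature.NumberTheory.DiophantineGeometry.Weight.dualOfPartition (m * m) lam).toMatIdx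
    let T : Submodule ℂ (MvPolynomial (Literature.NumberTheory.DiophantineGeometry.MatIdx m × Literature.NumberTheory.DiophantineGeometry.MatIdx m) ℂ) := MvPolynomial.homogeneousSubmodule (Literature.NumberTheory.DiophantineGeometry.MatIdx m × Literature.NumberTheory.DiophantineGeometry.MatIdx m) ℂ (m * δ) ⊓ ((MvPolynomial.vanishingIdeal ℂ {p : Literature.NumberTheory.DiophantineGeometry.MatIdx m × Literature.NumberTheory.DiophantineGeometry.MatIdx m → ℂ | ∀ j : Literature.NumberTheory.DiophantineGeometry.MatIdx m, (fun i => p (j, i)) ∈ U}) ^ (δ * t)).restrictScalars ℂ ⊓ (⨅ (M : Matrix (Literature.NumberTheory.DiophantineGeometry.MatIdx m) (Literature.NumberTheory.DiophantineGeometry.MatIdx m) ℂ) (_ : Literature.Computability.AlgebraicComplexity.linSubst (Literature.NumberTheory.DiophantineGeometry.MatIdx m) ℂ M (Literature.NumberTheory.DiophantineGeometry.detFormLex ℂ m) = Literature.NumberTheory.DiophantineGeometry.detFormLex ℂ m), LinearMap.ker ((MvPolynomial.aeval (R := ℂ) fun p : Literature.NumberTheory.DiophantineGeometry.MatIdx m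 × Literature.NumberTheory.DiophantineGeometry.MatIdx m => ∑ l : Literature.NumberTheory.DiophantineGeometry.MatIdx m, M l p.2 • MvPolynomial.X (p.1, l)).toLinearMap - LinearMap.id (R := ℂ) (M := MvPolynomial (Literature.NumberTheory.DiophantineGeometry.MatIdx m × Literature.NumberTheory.DiophantineGeometry.MatIdx m) ℂ))) ⊓ (⨅ (g : Matrix.GeneralLinearGroup (Literature.NumberTheory.DiophantineGeometry.MatIdx m) ℂ) (_ : Literature.NumberTheory.DiophantineGeometry.IsUpperTriangular g), LinearMap.ker ((MvPolynomial.aeval (R := ℂ) fun p : Literature.NumberTheory.DiophantineGeometry.MatIdx m × Literature.NumberTheory.DiophantineGeometry.MatIdx m => ∑ l : Literature.NumberTheory.DiophantineGeometry.MatIdx m, ((g⁻¹ : Matrix.GeneralLinearGroup (Literature.NumberTheory.DiophantineGeometry.MatIdx m) ℂ) : Matrix (Literature.NumberTheory.DiophantineGeometry.MatIdx m) (Literature.NumberTheory.DiophantineGeometry.MatIdx m) ℂ) p.1 l • MvPolynomial.X (l, p.2)).toLinearMap - Literature.NumberTheory.DiophantineGeometry.weightChar χ g • LinearMap.id (R :=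 ℂ) (M := MvPolynomial (Literature.NumberTheory.DiophantineGeometry.MatIdx m × Literature.NumberTheory.DiophantineGeometry.MatIdx m) ℂ)))
    ∀ x, x ∈ highestWeightSpace (orbitCoordRep (detFormLex ℂ m) m) χ →
      orbitCoordToPoly (detFormLex ℂ m) m x ∈ T := by
  intro χ T x hx
  classical
  obtain ⟨F, rfl⟩ := Ideal.Quotient.mk_surjective x
  set f : MvPolynomial (MatIdx m) ℂ := detFormLex ℂ m with hf
  set P := orbitCoordToPoly f m (Ideal.Quotient.mk (orbitVanishingIdeal f m) F) with hP
  have hPgen : P = genericOrbitMap f m F := orbitCoordToPoly_mk f m F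
  have hsize : χ.size = -((m * δ : ℕ) : ℤ) := size_toMatIdx_dualOfPartition m lam hcard
  have hm : m ≠ 0 := NeZero.ne m
  simp only [T]
  refine Submodule.mem_inf.mpr ⟨Submodule.mem_inf.mpr ⟨Submodule.mem_inf.mpr ⟨?_, ?_⟩, ?_⟩, ?_⟩
  · -- (T1) degree `m δ`
    exact (mem_homogeneousSubmodule _ _).mpr (isHomogeneous_orbitCoordToPoly f m hx hsize)
  · -- (T2) vanishing to order `δ t` along `L_U`
    rw [Submodule.restrictScalars_mem]
    -- semi-invariance of the representative modulo the ideal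
    have hF : ∀ b : GL (MatIdx m) ℂ, IsUpperTriangular b →
        coordSubst m b F - weightChar χ b • F ∈ orbitVanishingIdeal f m :=
      fun b hb => sub_mem_of_mk_mem_highestWeightSpace f m hx hb
    -- the part of torus weight `χ` represents the same class
    set Fχ : MvPolynomial (DegIdx (MatIdx m) m) ℂ :=
      ∑ s ∈ F.support.filter (fun s => monWeight s = χ), monomial s (coeff s F) with hFχ
    have hdiff : F - Fχ ∈ orbitVanishingIdeal f m := by
      set W : Finset (Weight (MatIdx m)) := insert χ (F.support.image monWeight) with hW
      have hmaps : ∀ s ∈ F.support, monWeight s ∈ W := fun s hs =>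
        Finset.mem_insert_of_mem (Finset.mem_image_of_mem _ hs)
      have hFsum : F = ∑ v ∈ W, ∑ s ∈ F.support.filter (fun s => monWeight s = v),
          monomial s (coeff s F) := by
        conv_lhs => rw [← F.support_sum_monomial_coeff]
        exact (Finset.sum_fiberwise_of_maps_to hmaps _).symm
      have hsplit : F - Fχ = ∑ v ∈ W.erase χ, ∑ s ∈ F.support.filter (fun s => monWeight s = v),
          monomial s (coeff s F) := by
        rw [sub_eq_iff_eq_add, hFχ, Finset.sum_erase_add _ _ (Finset.mem_insert_self χ _), ← hFsum]
      rw [hsplit]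
      exact Ideal.sum_mem _ fun v hv =>
        sum_filter_monWeight_mem_orbitVanishingIdeal f (fun b hb => hF b hb.isUpperTriangular)
          (Finset.ne_of_mem_erase hv)
    have hPχ : P = genericOrbitMap f m Fχ := by
      rw [hP, (Ideal.Quotient.eq (I := orbitVanishingIdeal f m)).mpr hdiff, orbitCoordToPoly_mk]
    rw [hPχ, hFχ, map_sum]
    refine Ideal.sum_mem _ fun s hs => ?_
    -- every monomial of `Fχ` has degree `δ`
    have hw : monWeight s = χ := (Finset.mem_filter.mp hs).2
    have hdeg : s.degree = δ := by
      have hsz := size_monWeight s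
      rw [hw, hsize, neg_inj, Nat.cast_inj] at hsz
      exact (Nat.eq_of_mul_eq_mul_left (Nat.pos_of_ne_zero hm) hsz).symm
    -- `genericOrbitMap (c X^s) = c ∏_d c_d^(s d) ∈ (I^t)^(|s|)`
    rw [show (monomial s (coeff s F) : MvPolynomial (DegIdx (MatIdx m) m) ℂ) =
        C (coeff s F) * s.prod (fun d e => (X d : MvPolynomial (DegIdx (MatIdx m) m) ℂ) ^ e) from
      monomial_eq, map_mul]
    refine Ideal.mul_mem_left _ _ ?_
    rw [Finsupp.prod, map_prod]
    have hmem : ∏ d ∈ s.support, genericOrbitMap f m ((X d : MvPolynomial (DegIdx (MatIdx m) m) ℂ) ^ s d) ∈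
        ∏ d ∈ s.support, ((MvPolynomial.vanishingIdeal ℂ
          {pt : MatIdx m × MatIdx m → ℂ | ∀ j : MatIdx m, (fun i => pt (j, i)) ∈ U}) ^ t) ^ s d :=
      Ideal.prod_mem_prod fun d _ => by
        rw [map_pow]
        exact Ideal.pow_mem_pow (hcoeff d) _
    rw [Finset.prod_pow_eq_pow_sum, ← Finsupp.degree_apply, hdeg, ← pow_mul, Nat.mul_comm t δ] at hmem
    exact hmem
  · -- (T3) right invariance under the End-stabiliser of `det_m`, as a polynomial identity
    simp only [Submodule.mem_iInf, LinearMap.mem_ker, LinearMap.sub_apply, LinearMap.id_apply,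
      AlgHom.toLinearMap_apply, sub_eq_zero]
    intro M hM
    rw [hPgen]
    apply MvPolynomial.funext
    intro A
    set A' : Matrix (MatIdx m) (MatIdx m) ℂ := Matrix.of fun i j => A (i, j) with hA'
    have hA : (fun p : MatIdx m × MatIdx m => A' p.1 p.2) = A := by
      funext p
      rfl
    have hsubst : (fun p : MatIdx m × MatIdx m =>
        aeval A (∑ l, M l p.2 • (X (p.1, l) : MvPolynomial (MatIdx m × MatIdx m) ℂ))) =
        fun p => (A' * M) p.1 p.2 := by
      funext p
      simp only [map_sum, map_smul, aeval_X, Matrix.mul_apply, hA', Matrix.of_apply, smul_eq_mul]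
      exact Finset.sum_congr rfl fun l _ => mul_comm _ _
    calc eval A (aeval (fun p : MatIdx m × MatIdx m =>
            ∑ l, M l p.2 • (X (p.1, l) : MvPolynomial (MatIdx m × MatIdx m) ℂ)) (genericOrbitMap f m F))
        = aeval A (aeval (fun p : MatIdx m × MatIdx m =>
            ∑ l, M l p.2 • (X (p.1, l) : MvPolynomial (MatIdx m × MatIdx m) ℂ)) (genericOrbitMap f m F)) :=
          rfl
      _ = aeval (fun p : MatIdx m × MatIdx m =>
            aeval A (∑ l, M l p.2 • (X (p.1, l) : MvPolynomial (MatIdx m × MatIdx m) ℂ)))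
            (genericOrbitMap f m F) := comp_aeval_apply _ _ _
      _ = eval (fun p : MatIdx m × MatIdx m => (A' * M) p.1 p.2) (genericOrbitMap f m F) := by
          rw [hsubst]
          rfl
      _ = aeval (formCoeff m (linSubst (MatIdx m) ℂ (A' * M) f)) F := eval_genericOrbitMap f m F _
      _ = aeval (formCoeff m (linSubst (MatIdx m) ℂ A' f)) F := by
          rw [linSubst_mul, AlgHom.comp_apply, hM]
      _ = eval (fun p : MatIdx m × MatIdx m => A' p.1 p.2) (genericOrbitMap f m F) :=
          (eval_genericOrbitMap f m F A').symm
      _ = eval A (genericOrbitMap f m F) := by rw [hA]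
  · -- (T4) left Borel semi-invariance of weight `λ*`, as a polynomial identity (density of `GL`)
    simp only [Submodule.mem_iInf, LinearMap.mem_ker, LinearMap.sub_apply, LinearMap.smul_apply,
      LinearMap.id_apply, AlgHom.toLinearMap_apply, sub_eq_zero]
    intro g hg
    have hg' : IsUpperTriangular g⁻¹ := (borelSubgroup (MatIdx m) ℂ).inv_mem hg
    apply MvPolynomial.eq_of_eval_eq_on_gl
    intro A
    have hsubst : (fun p : MatIdx m × MatIdx m =>
        aeval (fun ij : MatIdx m × MatIdx m => (A : Matrix (MatIdx m) (MatIdx m) ℂ) ij.1 ij.2)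
          (∑ l, ((g⁻¹ : GL (MatIdx m) ℂ) : Matrix (MatIdx m) (MatIdx m) ℂ) p.1 l •
            (X (l, p.2) : MvPolynomial (MatIdx m × MatIdx m) ℂ))) =
        fun p => (((g⁻¹ : GL (MatIdx m) ℂ) : Matrix (MatIdx m) (MatIdx m) ℂ) *
          (A : Matrix (MatIdx m) (MatIdx m) ℂ)) p.1 p.2 := by
      funext p
      simp only [map_sum, map_smul, aeval_X, Matrix.mul_apply, smul_eq_mul]
    calc eval (fun ij : MatIdx m × MatIdx m => (A : Matrix (MatIdx m) (MatIdx m) ℂ) ij.1 ij.2)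
          (aeval (fun p : MatIdx m × MatIdx m =>
            ∑ l, ((g⁻¹ : GL (MatIdx m) ℂ) : Matrix (MatIdx m) (MatIdx m) ℂ) p.1 l •
              (X (l, p.2) : MvPolynomial (MatIdx m × MatIdx m) ℂ)) P)
        = aeval (fun ij : MatIdx m × MatIdx m => (A : Matrix (MatIdx m) (MatIdx m) ℂ) ij.1 ij.2)
          (aeval (fun p : MatIdx m × MatIdx m =>
            ∑ l, ((g⁻¹ : GL (MatIdx m) ℂ) : Matrix (MatIdx m) (MatIdx m) ℂ) p.1 l •
              (X (l, p.2) : MvPolynomial (MatIdx m × MatIdx m) ℂ)) P) := rfl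
      _ = aeval (fun p : MatIdx m × MatIdx m =>
            aeval (fun ij : MatIdx m × MatIdx m => (A : Matrix (MatIdx m) (MatIdx m) ℂ) ij.1 ij.2)
              (∑ l, ((g⁻¹ : GL (MatIdx m) ℂ) : Matrix (MatIdx m) (MatIdx m) ℂ) p.1 l •
                (X (l, p.2) : MvPolynomial (MatIdx m × MatIdx m) ℂ))) P := comp_aeval_apply _ _ _
      _ = eval (fun p : MatIdx m × MatIdx m => (((g⁻¹ : GL (MatIdx m) ℂ) : Matrix (MatIdx m) (MatIdx m) ℂ) *
            (A : Matrix (MatIdx m) (MatIdx m) ℂ)) p.1 p.2) P := by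
          rw [hsubst]
          rfl
      _ = (weightChar χ g⁻¹)⁻¹ *
            eval (fun ij : MatIdx m × MatIdx m => (A : Matrix (MatIdx m) (MatIdx m) ℂ) ij.1 ij.2) P :=
          eval_orbitCoordToPoly_mul_left f m hx hg' A
      _ = eval (fun ij : MatIdx m × MatIdx m => (A : Matrix (MatIdx m) (MatIdx m) ℂ) ij.1 ij.2)
            (weightChar χ g • P) := by
          rw [weightChar_inv χ hg, inv_inv, smul_eval]

/-! ## Composition -/

/-- **The line concludes the crux — complete proof.** `ValuativeGCT.ValuativeBound` concluded BY
NAME with no hypotheses (sorry-free; axioms `propext`, `Classical.choice`, `Quot.sound`): the two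
W-side stubs (both proved above, invoked by their registered names) give `C⁺ : det_m ∈ J'_U^(m-r)`,
`coeffTransport` turns it into `CoeffVanishingOrder`-type membership of the coefficients of
`det_m(x·A)`, `rangeInTruncation` puts the highest-weight classes into `T_U(λ)`, and `hwToPoly` is
injective into the finite-dimensional `T_U(λ) ≤ Hom_(mδ)`. -/
theorem ValuativeBound_of : ValuativeGCT.ValuativeBound := by
  intro m _ U r hU δ lam hcard χ T
  -- (A) the W-side estimate `C⁺ : det_m ∈ J'_U^(m-r)` — stub 2 fed pointwise by stub 1
  have hW : detFormLex ℂ m ∈ (Ideal.span {ℓ : MvPolynomial (MatIdx m) ℂ |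
      ℓ ∈ MvPolynomial.homogeneousSubmodule (MatIdx m) ℂ 1 ∧ ∀ u ∈ U, MvPolynomial.eval u ℓ = 0}) ^ (m - r) := by
    refine stub_linearPower_of_lineRestriction m (m - r) U (detFormLex ℂ m) fun u hu y => ?_
    rw [aeval_line_detFormLex]
    exact stub_kernelColumnDivisibility m r _ _ (hU u hu)
  -- (B) transport: every `x`-coefficient of `det_m(x·A)` vanishes to order `m - r` along `L_U`
  have hcoeff : ∀ d : DegIdx (MatIdx m) m,
      genericOrbitMap (detFormLex ℂ m) m (MvPolynomial.X d) ∈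
        (MvPolynomial.vanishingIdeal ℂ
          {pt : MatIdx m × MatIdx m → ℂ | ∀ j : MatIdx m, (fun i => pt (j, i)) ∈ U}) ^ (m - r) := by
    intro d
    have h := coeffTransport m (m - r) U (detFormLex ℂ m) hW d.1
    simp only [genericOrbitMap, MvPolynomial.aeval_X]
    exact h
  -- (C) the pull-back lands in `T`, injectively; count dimensions
  have hrange := rangeInTruncation m U (m - r) δ lam hcard hcoeff
  have hle : LinearMap.range (hwToPoly (detFormLex ℂ m) m χ) ≤ T := by
    rintro _ ⟨x, rfl⟩
    exact hrange x x.2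
  have hTle : T ≤ MvPolynomial.homogeneousSubmodule (MatIdx m × MatIdx m) ℂ (m * δ) :=
    le_trans inf_le_left (le_trans inf_le_left inf_le_left)
  haveI : Module.Finite ℂ (MvPolynomial.homogeneousSubmodule (MatIdx m × MatIdx m) ℂ (m * δ)) :=
    Module.Finite.iff_fg.mpr (MvPolynomial.homogeneousSubmodule_fg _ _ (m * δ))
  haveI : Module.Finite ℂ T := Submodule.finiteDimensional_of_le hTle
  calc orbitMultiplicity ℂ (detFormLex ℂ m) m χ
      = Module.finrank ℂ (highestWeightSpace (orbitCoordRep (detFormLex ℂ m) m) χ) := rfl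
    _ = Module.finrank ℂ (LinearMap.range (hwToPoly (detFormLex ℂ m) m χ)) :=
        (LinearMap.finrank_range_of_inj (hwToPoly_injective (detFormLex ℂ m) m χ)).symm
    _ ≤ Module.finrank ℂ T := Submodule.finrank_mono hle

/-- **Corollary: the support item `CoeffVanishingOrder` (stmt-ValiantsHypothesis-12628).** Every
`x`-coefficient of `det_m(x·A)` lies in `I(L_U)^(m-r)` when all matrices of `U` have rank `≤ r`:
stub 1 → stub 2 → `coeffTransport`. -/
theorem coeffVanishingOrder_of : ValuativeGCT.CoeffVanishingOrder := by
  intro m U r hU d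
  have hW : detFormLex ℂ m ∈ (Ideal.span {ℓ : MvPolynomial (MatIdx m) ℂ |
      ℓ ∈ MvPolynomial.homogeneousSubmodule (MatIdx m) ℂ 1 ∧ ∀ u ∈ U, MvPolynomial.eval u ℓ = 0}) ^ (m - r) := by
    refine stub_linearPower_of_lineRestriction m (m - r) U (detFormLex ℂ m) fun u hu y => ?_
    rw [aeval_line_detFormLex]
    exact stub_kernelColumnDivisibility m r _ _ (hU u hu)
  have h := coeffTransport m (m - r) U (detFormLex ℂ m) hW d.1
  simp only [MvPolynomial.aeval_X]
  exact h

end Summit.ValiantsHypothesis.ValiantsHypothesis.Cruxes.ValuativeBound.DetTransversalOrderTransport
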